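import Literature.AlgebraicGeometry.ComplexMultiplication.OneTypeEigenblockSubfieldRestriction
import Literature.AlgebraicGeometry.ComplexMultiplication.PureEigenblockOfCommutingEndomorphisms
import HarnessLib

/-!
# One-type eigenblocks of `H¹(X(ℂ); ℚ)`: the subfield restriction in the tree's geometric vocabulary
# (`IsOfHodgeType` on `bettiCohomology X 1`, the format of route R-A's binder (HE))

Family `hodge`, layer `Literature/AlgebraicGeometry/ComplexMultiplication`; THEOREMS ONLY (no definition, no named
fact — D-0026).  Part 4 of the lane `OneTypeEigensystemCMHodgeMorphism` / `…AlgHomForm` /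
`OneTypeEigenblockSubfieldRestriction` (abstract weight-one Hodge structures): the same statements for
`V = H¹(X(ℂ); ℚ) = bettiCohomology X 1` of a smooth projective complex `X`, with Hodge types read through the tree's
`IsOfHodgeType d X 1 p q (ofRatClassBaseChange (ComplexPoints X) 1 ·)` — the vocabulary of
`PureEigenblockOfCommutingEndomorphisms` and of `EigenvectorsOfType` in `pub-hodgecm2-s2crux-idea-2/RA-Sketch.lean`
(binder (HE) `HeckeReflexEigenblock`).  The bridge is the tree theorem
`HodgeTheory.BettiUniverse.mem_hodge_piece_iff` (`x ∈ (hodge hHD hX 1).piece p q ↔ IsOfHodgeType …`), with the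
tree's discharges `exists_isReal_hodgeModel_holds`, `hodgePQ_independent_of_hodgeModel_holds`: the Hodge structure of
record `HodgeTheory.BettiUniverse.hodge hHD hX 1` IS a `Motives.HodgeStructure (bettiCohomology X 1) 1`, so the
abstract theorems apply verbatim.

* `oneType_piece_iff_isOfHodgeType_one_zero` / `…_zero_one` — dictionary `piece 1 0 ↔ type (1,0)`,
  `piece 0 1 ↔ type (0,1)` for eigenvector families.
* **`allOrNothing_restrict_subfield_betti`** — for `X` smooth projective, a commutative `act : R →ₐ[ℚ] End_ℚ H¹`,
  an occurring one-type eigensystem `t` (one-type in the `IsOfHodgeType` format of `PureEigenblock…`), a subfield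
  `e : K → E(t)` and `Ψ ⊆ Hom(K, ℂ)` with «`τ` of type `(1,0)` ↔ `τ ∘ e ∈ Ψ`»: the restricted action
  `ρ ∘ e : K →ₐ[ℚ] End_ℚ W(t)` on the eigenblock has ALL-OR-NOTHING `σ`-eigenvectors — of type `(1,0)` for `σ ∈ Ψ`,
  `(0,1)` for `σ ∉ Ψ` — literally the two clauses of (HE) for `(W, ρ) := (eigenblock act t, eigenfieldAction ∘ e)`.

Relies on: nothing unproved (axioms `propext`, `Classical.choice`, `Quot.sound`).

## References

* [Shimura1998] G. Shimura, *Abelian Varieties with Complex Multiplication and Modular Functions* (1998), §8.3, §24.15.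
* [Deligne1982HodgeCycles] P. Deligne, *Hodge cycles on abelian varieties*, LNM 900 (1982), §4–§5.
* [VoisinHodgeI2002] C. Voisin, *Hodge Theory and Complex Algebraic Geometry I* (2002), §7.1.1 (Hodge types).

## Provenance

Cell `pub-hodgecm2` (COR-CM), count-neutral own lane ONETYPE-EIGEN-CMHOM of seat `pub-hodgecm2-b26` (gen 23), part 4.
-/

noncomputable section

open scoped TensorProduct
open Module

namespace Literature.AlgebraicGeometry.ComplexMultiplication

open Literature.AlgebraicGeometry.Motives (SchemeOver IsSmoothProjective ComplexPoints bettiCohomology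
  ofRatClassBaseChange)
open Literature.AlgebraicGeometry.HodgeTheory (IsOfHodgeType exists_isReal_hodgeModel_holds
  hodgePQ_independent_of_hodgeModel_holds)

section Betti

variable {R : Type*} [CommRing R] [Algebra ℚ R] {d : ℕ} {X : SchemeOver ℂ}
  (act : R →ₐ[ℚ] Module.End ℚ (bettiCohomology X 1)) (t : R →ₐ[ℚ] ℂ)

omit [Algebra ℚ R] in
/-- **`V^{1,0}` of the Hodge structure of record is the set of classes of type `(1,0)`** (the tree's
`BettiUniverse.mem_hodge_piece_iff`, degree one). [cite: VoisinHodgeI2002, §7.1.1] -/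
theorem mem_hodge_piece_one_zero_iff' (hX : IsSmoothProjective d X) (x : ℂ ⊗[ℚ] bettiCohomology X 1) :
    x ∈ (HodgeTheory.BettiUniverse.hodge exists_isReal_hodgeModel_holds hX 1).piece 1 0 ↔
      IsOfHodgeType d X 1 1 0 (ofRatClassBaseChange (ComplexPoints X) 1 x) := by
  have h := HodgeTheory.BettiUniverse.mem_hodge_piece_iff exists_isReal_hodgeModel_holds
    hodgePQ_independent_of_hodgeModel_holds hX (k := 1) (p := 1) (q := 0) rfl x
  push_cast at h
  exact h

omit [Algebra ℚ R] in
/-- **`V^{0,1}` of the Hodge structure of record is the set of classes of type `(0,1)`**.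
[cite: VoisinHodgeI2002, §7.1.1] -/
theorem mem_hodge_piece_zero_one_iff' (hX : IsSmoothProjective d X) (x : ℂ ⊗[ℚ] bettiCohomology X 1) :
    x ∈ (HodgeTheory.BettiUniverse.hodge exists_isReal_hodgeModel_holds hX 1).piece 0 1 ↔
      IsOfHodgeType d X 1 0 1 (ofRatClassBaseChange (ComplexPoints X) 1 x) := by
  have h := HodgeTheory.BettiUniverse.mem_hodge_piece_iff exists_isReal_hodgeModel_holds
    hodgePQ_independent_of_hodgeModel_holds hX (k := 1) (p := 0) (q := 1) rfl x
  push_cast at h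
  exact h

/-- **The subfield restriction of a one-type eigenblock of `H¹(X(ℂ); ℚ)` is all-or-nothing** — geometric form of
`allOrNothing_restrict_subfield` in the `IsOfHodgeType` vocabulary of `PureEigenblockOfCommutingEndomorphisms` and of
route R-A's binder (HE): for `X` smooth projective of dimension `d`, a commutative `ℚ`-algebra acting on `H¹`
(`act`), an occurring eigensystem `t` whose conjugate eigensystems have joint eigenvectors of ONE Hodge type each
(`hall`), a number field `K` embedded in the eigenvalue field by `e : K → E(t)`, and `Ψ ⊆ Hom(K, ℂ)` such that `τ` is
of type `(1,0)` iff `τ ∘ e ∈ Ψ` (`hind`, the INDUCED sign pattern): every joint `σ`-eigenvector (`σ : K → ℂ`) of the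
restricted action `b ↦ ρ(e b)` on `ℂ ⊗ W(t)`, read in `H¹(X(ℂ); ℂ)`, is of type `(1,0)` when `σ ∈ Ψ` and of type
`(0,1)` when `σ ∉ Ψ`. [cite: Shimura1998, §8.3 and §24.15 Theorem] [cite: Deligne1982HodgeCycles, §4–§5] -/
theorem allOrNothing_restrict_subfield_betti (hX : IsSmoothProjective d X)
    [FiniteDimensional ℚ (bettiCohomology X 1)] [NumberField (eigenfield t)]
    (hocc : ∃ x : ℂ ⊗[ℚ] bettiCohomology X 1, x ≠ 0 ∧ ∀ a, (act a).baseChange ℂ x = t a • x)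
    (hall : ∀ τ : eigenfield t →+* ℂ,
      (∀ x : ℂ ⊗[ℚ] bettiCohomology X 1, (∀ a, (act a).baseChange ℂ x = τ ⟨t a, apply_mem_eigenfield t a⟩ • x) →
        IsOfHodgeType d X 1 1 0 (ofRatClassBaseChange (ComplexPoints X) 1 x)) ∨
      (∀ x : ℂ ⊗[ℚ] bettiCohomology X 1, (∀ a, (act a).baseChange ℂ x = τ ⟨t a, apply_mem_eigenfield t a⟩ • x) →
        IsOfHodgeType d X 1 0 1 (ofRatClassBaseChange (ComplexPoints X) 1 x)))
    {K : Type} [Field K] [NumberField K] (e : K →+* eigenfield t) (Ψ : Set (K →+* ℂ))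
    (hind : ∀ τ : eigenfield t →+* ℂ,
      (∀ x : ℂ ⊗[ℚ] bettiCohomology X 1, (∀ a, (act a).baseChange ℂ x = τ ⟨t a, apply_mem_eigenfield t a⟩ • x) →
        IsOfHodgeType d X 1 1 0 (ofRatClassBaseChange (ComplexPoints X) 1 x)) ↔ τ.comp e ∈ Ψ)
    (σ : K →+* ℂ) :
    (σ ∈ Ψ → ∀ y : ℂ ⊗[ℚ] eigenblock act t,
      (∀ b : K, (((eigenfieldAction act t hocc).comp e.toRatAlgHom) b).baseChange ℂ y = σ b • y) →
        IsOfHodgeType d X 1 1 0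
          (ofRatClassBaseChange (ComplexPoints X) 1 ((eigenblock act t).subtype.baseChange ℂ y))) ∧
    (σ ∉ Ψ → ∀ y : ℂ ⊗[ℚ] eigenblock act t,
      (∀ b : K, (((eigenfieldAction act t hocc).comp e.toRatAlgHom) b).baseChange ℂ y = σ b • y) →
        IsOfHodgeType d X 1 0 1
          (ofRatClassBaseChange (ComplexPoints X) 1 ((eigenblock act t).subtype.baseChange ℂ y))) := by
  have h10 := mem_hodge_piece_one_zero_iff' hX
  have h01 := mem_hodge_piece_zero_one_iff' hX
  -- translate the one-type data into the piece vocabulary of the Hodge structure of record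
  have hall' : ∀ τ : eigenfield t →+* ℂ,
      (∀ x : ℂ ⊗[ℚ] bettiCohomology X 1, (∀ a, (act a).baseChange ℂ x = τ ⟨t a, apply_mem_eigenfield t a⟩ • x) →
        x ∈ (HodgeTheory.BettiUniverse.hodge exists_isReal_hodgeModel_holds hX 1).piece 1 0) ∨
      (∀ x : ℂ ⊗[ℚ] bettiCohomology X 1, (∀ a, (act a).baseChange ℂ x = τ ⟨t a, apply_mem_eigenfield t a⟩ • x) →
        x ∈ (HodgeTheory.BettiUniverse.hodge exists_isReal_hodgeModel_holds hX 1).piece 0 1) := fun τ ↦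
    (hall τ).imp (fun h x hx ↦ (h10 x).2 (h x hx)) (fun h x hx ↦ (h01 x).2 (h x hx))
  have hind' : ∀ τ : eigenfield t →+* ℂ,
      (∀ x : ℂ ⊗[ℚ] bettiCohomology X 1, (∀ a, (act a).baseChange ℂ x = τ ⟨t a, apply_mem_eigenfield t a⟩ • x) →
        x ∈ (HodgeTheory.BettiUniverse.hodge exists_isReal_hodgeModel_holds hX 1).piece 1 0) ↔ τ.comp e ∈ Ψ :=
    fun τ ↦ (forall_congr' fun x ↦ imp_congr_right fun _ ↦ h10 x).trans (hind τ)
  obtain ⟨hA, hB⟩ := allOrNothing_restrict_subfield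
    (HodgeTheory.BettiUniverse.hodge exists_isReal_hodgeModel_holds hX 1) act t hocc hall' e Ψ hind' σ
  exact ⟨fun hσ y hy ↦ (h10 _).1 (hA hσ y hy), fun hσ y hy ↦ (h01 _).1 (hB hσ y hy)⟩

end Betti

end Literature.AlgebraicGeometry.ComplexMultiplication

end
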